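import Summits.AnomalousDissipation.AnomalousDissipation.Theses.EnsembleRigidity

/-!
# `EnsembleRigidity.Assembly` (stmt-AnomalousDissipation-15512): proof

`Summit.AnomalousDissipation.AnomalousDissipation.Theses.EnsembleRigidity.Assembly` is the assembly
item of route `AnomalousDissipation/EnsembleRigidity`:
`GPStatisticalRigidity → GPMeanBoundedFamily → ResidualTransferSSS → EnsembleFloorTransfer →
AnomalousDissipation`.
Its body is, verbatim, the type of the route's planner-authored deciding theorem
`Summit.AnomalousDissipation.AnomalousDissipation.Theses.EnsembleRigidity.closes` (D-0027 §2.1,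
sorry-free in the route file, standard axioms): pin the Galloway–Proctor force `f_GP` (admissible by
the landed `stub_gpAdmissible`), take the mean-bounded lifted Leray–Hopf family `(E, ν_j, u_j, U_j)`
from `GPMeanBoundedFamily` and the rigidity constants `(c, δ₀)` at level `E` from
`GPStatisticalRigidity`, put `ε₀ = min c (δ₀ ^ 2)`; for `ν ∈ (0,1]` and a stationary statistical
solution `μ` of `(ν, f_GP)` with integrable energy `≤ E`, `ResidualTransferSSS` gives shell positivity
and the forced-Euler defect bound with `R = ν √G` (`G` = mean enstrophy), so either `R ≤ δ₀` and
rigidity pays `c ≤ R √G = ν G`, or `ν G ≥ R² > δ₀²`; hence `ensembleDissipation ν μ ≥ ε₀`, and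
`EnsembleFloorTransfer` carries the floor to `meanDissipation (ν_j) (u_j) ≥ ε₀`; the witnesses of
`Literature.Turb.ZerothLaw = AnomalousDissipation` are `(f_GP, ν, u₀, u, E, ε₀)`.
So the assembly is settled by re-applying `closes` after unfolding the definition; nothing else is
proved here (the four hypotheses are the route's own items).
Sources of the route step: Foias–Manley–Rosa–Temam 2001 Ch. IV (statistical solutions),
Doering–Foias 2002 §2–3.
-/

-- `Summit.<Summit>.<Problem>` is the tree's mandated summit-side namespace (CONVENTIONS §2); for this
-- single-conjunct summit the two coincide, so the duplicate is deliberate.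
set_option linter.dupNamespace false

namespace Summit.AnomalousDissipation.AnomalousDissipation.Theorems

/-- **Assembly of route `EnsembleRigidity`** (item stmt-AnomalousDissipation-15512):
`GPStatisticalRigidity → GPMeanBoundedFamily → ResidualTransferSSS → EnsembleFloorTransfer →
AnomalousDissipation`.
Proof (until the 2026-08-17 re-cut): the statement unfolded to the type of the route's deciding theorem
`Summit.AnomalousDissipation.AnomalousDissipation.Theses.EnsembleRigidity.closes`, which is applied
to the four hypotheses. [route AnomalousDissipation/EnsembleRigidity; FoiasManleyRosaTemam2001;
DoeringFoias2002] -/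
theorem ensembleRigidity_assembly_proof :
    Summit.AnomalousDissipation.AnomalousDissipation.Theses.EnsembleRigidity.Assembly := by
  unfold Summit.AnomalousDissipation.AnomalousDissipation.Theses.EnsembleRigidity.Assembly
  intro hX h₃ h₄ h₅
  -- buildfix 2026-08-20 (proof only; statement byte-identical): the route's deciding theorem `closes`
  -- was re-cut (judge-repair 2026-08-17) to take the split `GPTameDefectFloor`/`TameToRough` and now
  -- DERIVES `GPStatisticalRigidity` as its first step; the frame item keeps `GPStatisticalRigidity` as
  -- its first antecedent, so the proof below is the remainder of the `closes` chain verbatim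
  -- (route file `Theses/EnsembleRigidity.lean`, from "the pinned force" on), started at `hX`.
  -- the pinned force and its admissibility (landed Theorems fact)
  set fGP : UnitAddTorus (Fin 3) → EuclideanSpace ℝ (Fin 3) := fun x : UnitAddTorus (Fin 3) =>
    (Literature.Analysis.FluidPDE.Torus.stokesMode (Pi.single (2 : Fin 3) (1 : ℤ)) (EuclideanSpace.single (0 : Fin 3) (1 : ℝ)) false x +
      Literature.Analysis.FluidPDE.Torus.stokesMode (Pi.single (0 : Fin 3) (1 : ℤ)) (EuclideanSpace.single (1 : Fin 3) (1 : ℝ)) false x +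
      Literature.Analysis.FluidPDE.Torus.stokesMode (Pi.single (1 : Fin 3) (1 : ℤ)) (EuclideanSpace.single (2 : Fin 3) (1 : ℝ)) false x :
      EuclideanSpace ℝ (Fin 3)) with hfGP
  obtain ⟨hsm, hdf, hzm⟩ :=
    Summit.AnomalousDissipation.AnomalousDissipation.Theorems.SteadyStatesLoudBounded.GpAdmissible.stub_gpAdmissible
  -- crux 3: the mean-bounded lifted family
  obtain ⟨E, ν, u₀, u, U, hν, hν0, hLH, hU, hE⟩ := h₃ fGP hfGP
  -- crux 2: rigidity constants at level E
  obtain ⟨c, δ₀, hc, hδ₀, hrig⟩ := hX fGP hfGP E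
  set ε₀ : ℝ := min c (δ₀ ^ 2) with hε₀
  have hε₀pos : 0 < ε₀ := lt_min hc (pow_pos hδ₀ 2)
  -- ensemble floor at level E, for every viscosity in (0,1]
  have floor : ∀ ν' : ℝ, 0 < ν' → ν' ≤ 1 →
      ∀ μ : MeasureTheory.Measure (Literature.Analysis.FunctionSpaces.Torus.energySpace (Fin 3)),
        Literature.Analysis.FluidPDE.Torus.IsStationaryStatisticalSolution ν' fGP μ →
        MeasureTheory.Integrable (fun v : Literature.Analysis.FunctionSpaces.Torus.energySpace (Fin 3) => ‖v‖ ^ 2) μ →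
        Literature.Analysis.FluidPDE.Torus.ensembleEnergy μ ≤ E →
        ε₀ ≤ Literature.Analysis.FluidPDE.Torus.ensembleDissipation ν' μ := by
    intro ν' hν' hν'1 μ hμ hint hEμ
    have hfin : Literature.Analysis.FluidPDE.Torus.ensembleEnstrophy μ < ⊤ := hμ.enstrophy_finite
    obtain ⟨hshell, hres⟩ := h₄ ν' fGP μ hν' hsm hdf hzm hμ hint
    set G : ℝ := (Literature.Analysis.FluidPDE.Torus.ensembleEnstrophy μ).toReal with hG
    have hG0 : 0 ≤ G := ENNReal.toReal_nonneg
    have hsq : Real.sqrt G * Real.sqrt G = G := Real.mul_self_sqrt hG0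
    set R : ℝ := ν' * Real.sqrt G with hR
    have hR0 : 0 ≤ R := mul_nonneg hν'.le (Real.sqrt_nonneg _)
    have hdiss : Literature.Analysis.FluidPDE.Torus.ensembleDissipation ν' μ = ν' * G := rfl
    rw [hdiss]
    by_cases hRδ : R ≤ δ₀
    · -- rigidity branch: c ≤ R √G = ν' G
      have key := hrig μ hμ.prob hint hEμ hfin hshell R hR0 hRδ
        (fun Φ => ⟨(hres Φ).1, by simpa [hR, mul_assoc] using (hres Φ).2⟩)
      have : R * Real.sqrt G = ν' * G := by rw [hR, mul_assoc, hsq]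
      calc ε₀ ≤ c := min_le_left _ _
        _ ≤ R * Real.sqrt G := key
        _ = ν' * G := this
    · -- large-residual branch: ν' G = R² / ν' ≥ R² > δ₀²
      have hRgt : δ₀ < R := lt_of_not_ge hRδ
      have hR2 : δ₀ ^ 2 < R ^ 2 := by
        have := hδ₀.le
        nlinarith
      have hRsq : R ^ 2 = ν' * (ν' * G) := by
        have hsq2 : Real.sqrt G ^ 2 = G := Real.sq_sqrt hG0
        calc R ^ 2 = ν' ^ 2 * Real.sqrt G ^ 2 := by rw [hR]; ring
          _ = ν' * (ν' * G) := by rw [hsq2]; ring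
      have hνG0 : 0 ≤ ν' * G := mul_nonneg hν'.le hG0
      have hle : R ^ 2 ≤ ν' * G := by
        rw [hRsq]
        calc ν' * (ν' * G) ≤ 1 * (ν' * G) := by
              exact mul_le_mul_of_nonneg_right hν'1 hνG0
          _ = ν' * G := one_mul _
      calc ε₀ ≤ δ₀ ^ 2 := min_le_right _ _
        _ ≤ R ^ 2 := hR2.le
        _ ≤ ν' * G := hle
  -- path floor along the family (crux 5), then the summit witnesses
  have hdissj : ∀ j, ε₀ ≤ Literature.Analysis.FluidPDE.meanDissipation (ν j) (u j) := fun j =>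
    h₅ (ν j) E ε₀ fGP (u₀ j) (u j) (U j) (hν j).1 hsm hdf hzm (floor (ν j) (hν j).1 (hν j).2)
      (hLH j) (hU j) (hE j)
  exact ⟨fGP, hsm, hdf, hzm, ν, u₀, u, fun j => (hν j).1, hν0, hLH, ⟨E, hE⟩, ε₀, hε₀pos, hdissj⟩

end Summit.AnomalousDissipation.AnomalousDissipation.Theorems
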